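import Summits.BirchSwinnertonDyer.BirchSwinnertonDyer.Theorems.Rank1ResidualJetTransverseFamily
import Summits.BirchSwinnertonDyer.BirchSwinnertonDyer.Theorems.Rank1ResidualJetLocalRestriction
import HarnessLib

/-!
# T1 JET (cell `bsd-jet`), road K: the transverse family and its reconciliation `hT` for the H63
# assembly, OUTRIGHT at inert (Kolyvagin) primes — gap G2 supplied by
# `exists_localRestriction_compat`

HONEST FRAMING (programme file §HONESTY, verbatim): «no tranche here proves BSD; ARM L moves the
LITERAL column of an r ≤ 1 census into the kernel-proved-modulo-named-print column.» THEOREMS ONLY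
(seat `bsd-jet-pv-2`, session g3; `--supports stmt-BirchSwinnertonDyer-14418`, helper); 0 classes
move. `exists_transverseFamily_of_compat` (sibling `Rank1ResidualJetTransverseFamily.lean`) with its
hypothesis `hcompat` DISCHARGED by `exists_localRestriction_compat` (sibling
`Rank1ResidualJetLocalRestriction.lean`): for a conductor `c ≠ 0` whose prime factors are inert in `K`
every place of `K[ℓ]` containing `ℓ ∣ c` lies over THE prime `(ℓ)` of `K`, so G2 applies. The `𝒯`/`hT`
inputs of `JET.tamagawaExponent_le_mInfty_of_kernelInputs` are thereby kernel theorems.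
References: [cite: Jetchev2008, §3.1.2 (p. 814), §3.4.1 (p. 816)] [cite: SerreLocalFields1979, VII.§5 Prop. 3].
-/

set_option autoImplicit false

noncomputable section

open scoped Classical

open WeierstrassCurve IsDedekindDomain NumberField Field Literature.NumberTheory.EllipticCurves
  Literature.NumberTheory.EllipticCurves.ModularForms Literature.NumberTheory.EllipticCurves.Jetchev2008
  Literature.NumberTheory.GaloisRepresentations
  Literature.NumberTheory.GaloisRepresentations.DiscreteGaloisModule

namespace Summit.BirchSwinnertonDyer.Rank1Residual.JET

/-- **The local transverse family and its reconciliation `hT`, OUTRIGHT** for a conductor `c ≠ 0`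
whose prime factors are INERT in `K` (Kolyvagin primes; every place of `K` containing `ℓ ∣ c` is THE
prime `(ℓ)`, so every place of `K[ℓ]` over `ℓ` lies over it): `exists_transverseFamily_of_compat` with
`hcompat` supplied by `exists_localRestriction_compat` (G2). This discharges the `𝒯`/`hT` inputs of
`JET.tamagawaExponent_le_mInfty_of_kernelInputs`. [cite: Jetchev2008, §3.1.2 (p. 814), §3.4.1 (p. 816)]
[cite: SerreLocalFields1979, VII.§5 Prop. 3] -/
theorem exists_transverseFamily {K : Type} [Field K] [NumberField K] (W : WeierstrassCurve ℚ)
    (ι : K →+* ℂ) (n : ℤ) [∀ k : ℕ, NumberField (ringClassField K ι k)] {c : ℕ} (hc : c ≠ 0)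
    (hinert : ∀ ℓ ∈ c.primeFactors, (Ideal.span {(ℓ : 𝓞 K)}).IsPrime) :
    ∃ 𝒯 : SelmerStructure ((W.baseChange K).torsionGaloisModule n),
      (∀ v : HeightOneSpectrum (𝓞 K), 𝒯 (Sum.inr v) =
        (⨅ ℓ ∈ c.primeFactors.filter (fun ℓ : ℕ ↦ ((ℓ : ℕ) : 𝓞 K) ∈ v.asIdeal), transverseKer W K ι n ℓ).map
          (galoisCohomology.localization ((W.baseChange K).torsionGaloisModule n) (Sum.inr v) 1)) ∧
      ∀ x : galoisCohomology ((W.baseChange K).torsionGaloisModule n) 1,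
        (∀ w ∈ placesDividing K c,
          galoisCohomology.localization ((W.baseChange K).torsionGaloisModule n) (Sum.inr w) 1 x ∈
            𝒯 (Sum.inr w)) ↔
        ∀ ℓ ∈ c.primeFactors, x ∈ transverseKer W K ι n ℓ := by
  refine exists_transverseFamily_of_compat W ι n hc fun ℓ hℓ v hv w' hw' ↦ ?_
  have hℓp : ℓ.Prime := Nat.prime_of_mem_primeFactors hℓ
  -- `w'` lies over `v`: both lie over the inert prime `(ℓ)` of `K`
  haveI : w'.asIdeal.LiesOver v.asIdeal := by
    refine ⟨?_⟩
    have hunder : (ℓ : 𝓞 K) ∈ (w'.asIdeal.under (𝓞 K)) := by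
      rw [Ideal.under, Ideal.mem_comap, map_natCast]
      exact hw'
    have hne : Ideal.span {(ℓ : 𝓞 K)} ≠ ⊥ := by
      rw [Ne, Ideal.span_singleton_eq_bot]; exact_mod_cast hℓp.ne_zero
    have hmax : (Ideal.span {(ℓ : 𝓞 K)}).IsMaximal := (hinert ℓ hℓ).isMaximal hne
    have hv' : v.asIdeal = Ideal.span {(ℓ : 𝓞 K)} :=
      (hmax.eq_of_le v.isPrime.ne_top ((Ideal.span_singleton_le_iff_mem _).mpr hv)).symm
    have hw'' : w'.asIdeal.under (𝓞 K) = Ideal.span {(ℓ : 𝓞 K)} :=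
      (hmax.eq_of_le (Ideal.IsPrime.under (𝓞 K) w'.asIdeal).ne_top
        ((Ideal.span_singleton_le_iff_mem _).mpr hunder)).symm
    rw [hv', ← hw'']
  exact exists_localRestriction_compat _ (ringClassField K ι ℓ) v w'

end Summit.BirchSwinnertonDyer.Rank1Residual.JET

end
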